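import Summits.HodgeConjecture.CorCM.CMAbelianFourfoldClassification
import Literature.AlgebraicGeometry.HodgeTheory.AbelianFourfoldsStablyNondegenerate
import HarnessLib

/-!
# Ring 2 (cell topic `Summits/HodgeConjecture/Ring2/`; seat `lit`, gen 58): EVERY non-simple complex abelian FOURFOLD outside Moonen–Zarhin's case (a) is stably nondegenerate, and the Hodge conjecture holds for all its powers — UNCONDITIONALLY (the union of the Literature lane's non-CM half with the CorCM cell's CM half)

HONEST FRAMING (cell `pub-hodge-ring2`, verbatim): research route conditional on HC_CM; not a corollary;
Q11.4-sentence-2 already refuted in dim ≥ 3. `HC_CM` does NOT occur in this file: the two halves below are unconditional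
theorems of the tree. NEW as an assembly (hence under `Summits/`); no definition, no named fact, no `sorry`.

PLACEMENT: the cell brief's kernel-target topic `Summits/HodgeConjecture/Ring2/` (the flat `Theorems/` directory is
prover-only, D-0016; this seat is the Literature seat). Namespace follows the directory (D-0022).

THE PRINT. B. Moonen, Yu. Zarhin, *Hodge classes on abelian varieties of low dimension*, Math. Ann. **315** (1999)
711–733, Thm. 0.1: «Let `X` be a complex abelian variety with `dim(X) ≤ 4`. […] (a) The abelian variety `X` is
isogenous to a product `X₁ × X₂` where `X₁` is an elliptic curve with complex multiplication by an imaginary quadratic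
field `k` and where `X₂` is a simple abelian threefold such that there exists an embedding `k ↪ End⁰(X₂)`. […]
(4) Suppose we are not in one of the cases (a), (b), (c) or (d). Then `Hg(X) = Sp_D(V,φ)` and `B•(Xⁿ) = D•(Xⁿ)` for all
`n`» ((b), (c), (d) are simple fourfolds), proved for non-simple `X` in §5 (5.4) (`X` not of CM type) and (5.5) (`X` of
CM type) [held: `paper:arxiv-math_9901113`, chunks p0001 L77–L121, p0009 L83–L108].

THE TWO HALVES, BY NAME.
* `X` NOT of CM type — the Literature lane's
  `Literature.AlgebraicGeometry.HodgeTheory.isStablyNondegenerate_of_dim_eq_four_of_not_isSimple_of_not_isOfCMType`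
  (`HodgeTheory/AbelianFourfoldsStablyNondegenerate`, Moonen–Zarhin (5.4): Poincaré split `E × T` / `S₁ × S₂`, the rows
  `isStablyNondegenerate_nonCMCurve_prod_threefold`, `isStablyNondegenerate_curve_prod_of_isSimple_threefold`,
  `isStablyNondegenerate_prod_simpleSurface_of_dim_le_two`, four elliptic curves), case (a) excluded in the ISOGENY form
  «`E × T → X` an isogeny, `E` CM, `T` simple ⟹ `End⁰(E) ↪̸ End⁰(T)`»;
* `X` OF CM type — the CorCM cell's `Summit.HodgeConjecture.CorCM.isDivisorGenerated_iff_of_not_isSimple_of_dim_four`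
  with `isDivisorGenerated_of_avDominatedBy_powSucc_of_isOfCMType_of_dim_four` (`CorCM/CMAbelianFourfoldClassification`,
  `CorCM/CMAbelianFourfoldPowers`, Moonen–Zarhin (5.5) through the type-rank calculus: two simple CM surfaces, CM curves
  times a simple CM surface, …), case (a) excluded in the DOMINATION form «no elliptic curve `E` and simple threefold `T`,
  both isogeny factors of `X` (`AVDominatedBy`), with `End⁰(E) ↪ End⁰(T)`».
The domination form implies the isogeny form (the factors of `E × T ∼ X` are isogeny factors of `X`:
`SliceExhaustion.avDominatedBy_prod_left`, `avDominatedBy_prod_right`, `AVDominatedBy.trans_isIsogeny_hom`), so the union is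
stated with the domination form.

RESULTS (`X : AbelianVariety ℂ`, `dim X = 4`, `X` not simple, outside case (a)):
**`isStablyNondegenerate_of_dim_eq_four_of_not_isSimple`** (`B•(Xⁿ) = D•(Xⁿ)` for all `n`);
**`hodgeConjectureFor_powSucc_of_dim_eq_four_of_not_isSimple`**, `hodgeConjectureFor_of_dim_eq_four_of_not_isSimple`,
`hodgeConjectureFor_of_isIsogenous_powSucc_of_dim_eq_four_of_not_isSimple` — the Hodge conjecture for every power of
every such fourfold and for everything isogenous to such a power, UNCONDITIONALLY; and, with NO hypothesis at all (case (a)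
cannot occur: a simple threefold is never an isogeny factor, `not_avDominatedBy_of_forall_hom_eq_zero`,
`hom_eq_zero_of_isSimple_of_dim_lt`): **`isStablyNondegenerate_surface_prod_surface (h₁ : S₁.dim = 2) (h₂ : S₂.dim = 2)`**
— EVERY product of two complex abelian surfaces is stably nondegenerate, **`hodgeConjectureFor_powSucc_surface_prod_surface`**
(the Hodge conjecture for all powers of every `S₁ × S₂`; the product itself is Ramón Marí 2008 Prop. 2.18 at `r = 2`),
**`isStablyNondegenerate_curve_prod_threefold_of_not_isSimple (hE : E.dim = 1) (hT3 : T.dim = 3) (hT : ¬ T.IsSimple)`**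
and its HC corollary. Not covered, by name: case (a) itself
(`B² ≠ D²`: the Weil classes — CorCM `exists_exceptional_two_of_isIsogenous_curve_prod_threefold` for `X` of CM type;
for the Weil-type members `E_k × T`, `End⁰(T) ≅ k`, the Hodge conjecture for `X` itself is Markman's theorem on fourfold
Weil classes, seats `ab-weil`), and the SIMPLE fourfolds (b)–(d)/(4) (Moonen–Zarhin 1995).

## References
* [MoonenZarhin1999LowDim] B. Moonen, Yu. Zarhin, Math. Ann. 315 (1999) 711–733, Thm. 0.1 (a), (4), §5 (5.4)–(5.5).
* [MumfordAV1970] D. Mumford, *Abelian Varieties* (1970), §19 Thm. 1 and Cor. 1–2 (pp. 173–174).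
* [RamonMari2008] J. J. Ramón Marí, Collect. Math. 59 (2008) 1–26, Prop. 2.18 with `r = 2` (the printed statement «the
  Hodge conjecture holds for `A₁ × A₂`, `dim A_i ≤ 2`» certified by the `S₁ × S₂` rows of both halves).
-/

noncomputable section

open CategoryTheory

namespace Summit.HodgeConjecture.Ring2.NonSimpleFourfolds

open Literature.AlgebraicGeometry.Motives (AbelianVariety)
open Literature.AlgebraicGeometry.Motives.AbelianVariety
open Literature.AlgebraicGeometry.HodgeTheory
open Literature.AlgebraicGeometry.Milne1999
open Summit.HodgeConjecture.CorCM
open Summit.HodgeConjecture.CorCM.Domination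

variable {X : AbelianVariety ℂ}

/-- **The domination form of «not case (a)» implies the isogeny form**: if no elliptic curve and simple threefold which
are both isogeny factors of `X` admit `End⁰(E) ↪ End⁰(T)`, then for every isogeny `E × T → X` with `E` of CM type and
`T` simple there is no such embedding. [cite: MoonenZarhin1999LowDim, Thm. 0.1 (a)] [cite: MumfordAV1970, §19 Thm. 1 (pp. 173–174)] -/
theorem isEmpty_ringHom_of_not_exists_factors
    (hna : ¬ ∃ E T : AbelianVariety ℂ, E.dim = 1 ∧ T.IsSimple ∧ T.dim = 3 ∧
      AVDominatedBy E X ∧ AVDominatedBy T X ∧ Nonempty (E.endAlgebra →+* T.endAlgebra)) :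
    ∀ E T : AbelianVariety ℂ, E.dim = 1 → T.dim = 3 → T.IsSimple → IsOfCMType E →
      AbelianVariety.IsIsogenous (E.prod T) X → IsEmpty (E.endAlgebra →+* T.endAlgebra) := by
  intro E T hE hT3 hTs _ hiso
  by_contra hne
  rw [not_isEmpty_iff] at hne
  obtain ⟨g, hg⟩ := hiso
  exact hna ⟨E, T, hE, hTs, hT3, (SliceExhaustion.avDominatedBy_prod_left E T).trans_isIsogeny_hom hg,
    (avDominatedBy_prod_right E T).trans_isIsogeny_hom hg, hne⟩

/-- **MOONEN–ZARHIN Thm. 0.1 (4) FOR NON-SIMPLE FOURFOLDS — UNCONDITIONAL.** Every non-simple complex abelian fourfold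
`X` outside case (a) (no elliptic curve `E` and simple threefold `T`, both isogeny factors of `X`, with
`End⁰(E) ↪ End⁰(T)`) is stably nondegenerate: `B•(Xⁿ) = D•(Xⁿ)` for all `n`. `X` not of CM type: the Literature theorem
(5.4); `X` of CM type: the CorCM classification (5.5) — `X` is divisor-generated, hence so is every power.
[cite: MoonenZarhin1999LowDim, Thm. 0.1 (4) and §5 (5.4)–(5.5)] -/
theorem isStablyNondegenerate_of_dim_eq_four_of_not_isSimple (hX4 : X.dim = 4) (hX : ¬ X.IsSimple)
    (hna : ¬ ∃ E T : AbelianVariety ℂ, E.dim = 1 ∧ T.IsSimple ∧ T.dim = 3 ∧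
      AVDominatedBy E X ∧ AVDominatedBy T X ∧ Nonempty (E.endAlgebra →+* T.endAlgebra)) :
    IsStablyNondegenerate X := by
  by_cases hcm : IsOfCMType X
  · have hXD : IsDivisorGenerated X := (isDivisorGenerated_iff_of_not_isSimple_of_dim_four hcm hX4 hX).2 hna
    exact fun N => isDivisorGenerated_of_avDominatedBy_powSucc_of_isOfCMType_of_dim_four hcm hX4 hXD
      (AVDominatedBy.refl (X.powSucc N))
  · exact isStablyNondegenerate_of_dim_eq_four_of_not_isSimple_of_not_isOfCMType hX4 hX hcm
      (isEmpty_ringHom_of_not_exists_factors hna)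

/-- **The Hodge conjecture for every power `X^{N+1}` of every non-simple complex abelian fourfold outside case (a) —
UNCONDITIONAL** (`B = D` on all powers and Lefschetz `(1,1)`). [cite: MoonenZarhin1999LowDim, Thm. 0.1 (4)] -/
theorem hodgeConjectureFor_powSucc_of_dim_eq_four_of_not_isSimple (hX4 : X.dim = 4) (hX : ¬ X.IsSimple)
    (hna : ¬ ∃ E T : AbelianVariety ℂ, E.dim = 1 ∧ T.IsSimple ∧ T.dim = 3 ∧
      AVDominatedBy E X ∧ AVDominatedBy T X ∧ Nonempty (E.endAlgebra →+* T.endAlgebra)) (N : ℕ) :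
    HodgeConjectureFor (X.powSucc N).dim (X.powSucc N).X :=
  (isStablyNondegenerate_of_dim_eq_four_of_not_isSimple hX4 hX hna).hodgeConjectureFor_powSucc N

/-- **The Hodge conjecture for the fourfold itself** (`N = 0`). [cite: MoonenZarhin1999LowDim, Thm. 0.1 (4)] -/
theorem hodgeConjectureFor_of_dim_eq_four_of_not_isSimple (hX4 : X.dim = 4) (hX : ¬ X.IsSimple)
    (hna : ¬ ∃ E T : AbelianVariety ℂ, E.dim = 1 ∧ T.IsSimple ∧ T.dim = 3 ∧
      AVDominatedBy E X ∧ AVDominatedBy T X ∧ Nonempty (E.endAlgebra →+* T.endAlgebra)) :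
    HodgeConjectureFor X.dim X.X :=
  (isStablyNondegenerate_of_dim_eq_four_of_not_isSimple hX4 hX hna).hodgeConjectureFor

/-- **The Hodge conjecture for everything isogenous to a power of a non-simple fourfold outside case (a)**,
unconditionally. [cite: MoonenZarhin1999LowDim, Thm. 0.1 (4)] [cite: MumfordAV1970, §19 Thm. 1 (pp. 173–174)] -/
theorem hodgeConjectureFor_of_isIsogenous_powSucc_of_dim_eq_four_of_not_isSimple (hX4 : X.dim = 4)
    (hX : ¬ X.IsSimple)
    (hna : ¬ ∃ E T : AbelianVariety ℂ, E.dim = 1 ∧ T.IsSimple ∧ T.dim = 3 ∧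
      AVDominatedBy E X ∧ AVDominatedBy T X ∧ Nonempty (E.endAlgebra →+* T.endAlgebra))
    {Y : AbelianVariety ℂ} {N : ℕ} (hY : AbelianVariety.IsIsogenous Y (X.powSucc N)) :
    HodgeConjectureFor Y.dim Y.X :=
  (isStablyNondegenerate_of_dim_eq_four_of_not_isSimple hX4 hX hna).hodgeConjectureFor_of_isIsogenous_powSucc hY

/-! ### The shapes where case (a) cannot occur: `S₁ × S₂` and `E × T` with `T` not simple — no hypothesis at all -/

/-- A homomorphism to a SIMPLE abelian variety of larger dimension vanishes (a non-zero one would be surjective).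
[cite: MumfordAV1970, §19 Cor. 2 of Thm. 1 (proof)] -/
theorem hom_eq_zero_of_isSimple_of_dim_lt {S T : AbelianVariety ℂ} (hT : T.IsSimple) (h : S.dim < T.dim)
    (f : S ⟶ T) : f = 0 := by
  by_contra hf
  have := dim_le_of_isSimple_of_ne_zero f hT hf
  omega

/-- If every homomorphism `P ⟶ T` vanishes and `dim T > 0`, then `T` is not an isogeny factor of `P`
(`s ≫ π = N • 𝟙 T` with `π = 0` forces `N • 𝟙 T = 0`). [cite: MumfordAV1970, §19 Thm. 1 (pp. 173–174)] -/
theorem not_avDominatedBy_of_forall_hom_eq_zero {T P : AbelianVariety ℂ} (h0 : 0 < T.dim)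
    (h : ∀ π : P ⟶ T, π = 0) : ¬ AVDominatedBy T P := by
  rintro ⟨s, π, N, hN, hsπ⟩
  exact (ne_zero_of_comp_eq_nsmul_id hN hsπ h0).2 (h π)

/-- A product of two positive-dimensional abelian varieties is not simple (`S₁ ↪ S₁ × S₂`, `x ↦ (x, 0)`, is a closed
immersion split by the first projection). [cite: MumfordAV1970, §19 Thm. 1 (pp. 173–174)] -/
theorem not_isSimple_prod_of_dim_pos {S₁ S₂ : AbelianVariety ℂ} (h₁ : 0 < S₁.dim) (h₂ : 0 < S₂.dim) :
    ¬ (S₁.prod S₂).IsSimple := fun hs =>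
  hs S₁ (prodLift (𝟙 S₁) (0 : S₁ ⟶ S₂))
    (isClosedImmersion_of_comp_eq_id _ (AbelianVariety.fst S₁ S₂) (prodLift_fst _ _)) h₁ (by rw [dim_prod]; omega)

/-- **EVERY product `S₁ × S₂` of two complex abelian surfaces is stably nondegenerate — UNCONDITIONAL, no hypothesis**
(case (a) cannot occur: a simple threefold is not an isogeny factor of `S₁ × S₂`, every homomorphism `S_i → T`
vanishing by dimension). With both halves: `S₁`, `S₂` arbitrary (simple or not, CM or not).
[cite: MoonenZarhin1999LowDim, Thm. 0.1 (4) and §5 (5.4)–(5.5)] [cite: RamonMari2008, Prop. 2.18] -/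
theorem isStablyNondegenerate_surface_prod_surface {S₁ S₂ : AbelianVariety ℂ} (h₁ : S₁.dim = 2) (h₂ : S₂.dim = 2) :
    IsStablyNondegenerate (S₁.prod S₂) := by
  refine isStablyNondegenerate_of_dim_eq_four_of_not_isSimple (by rw [dim_prod]; omega)
    (not_isSimple_prod_of_dim_pos (by omega) (by omega)) ?_
  rintro ⟨E, T, -, hTs, hT3, -, hTX, -⟩
  exact not_avDominatedBy_of_forall_hom_eq_zero (T := T) (by omega)
    (fun π => prod_hom_eq_zero_of_forall (fun f => hom_eq_zero_of_isSimple_of_dim_lt hTs (by omega) f)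
      (fun g => hom_eq_zero_of_isSimple_of_dim_lt hTs (by omega) g) π) hTX

/-- **The Hodge conjecture for every power `(S₁ × S₂)^{N+1}` of EVERY product of two complex abelian surfaces —
UNCONDITIONAL** (in print for the product itself: Ramón Marí 2008 Prop. 2.18 with `r = 2`; here with all powers, from
Moonen–Zarhin's `B• = D•`). [cite: MoonenZarhin1999LowDim, Thm. 0.1 (4)] [cite: RamonMari2008, Prop. 2.18] -/
theorem hodgeConjectureFor_powSucc_surface_prod_surface {S₁ S₂ : AbelianVariety ℂ} (h₁ : S₁.dim = 2)
    (h₂ : S₂.dim = 2) (N : ℕ) :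
    HodgeConjectureFor ((S₁.prod S₂).powSucc N).dim ((S₁.prod S₂).powSucc N).X :=
  (isStablyNondegenerate_surface_prod_surface h₁ h₂).hodgeConjectureFor_powSucc N

/-- **The Hodge conjecture for `S₁ × S₂` itself**, two arbitrary complex abelian surfaces. [cite: RamonMari2008, Prop. 2.18]
[cite: MoonenZarhin1999LowDim, Thm. 0.1 (4)] -/
theorem hodgeConjectureFor_surface_prod_surface {S₁ S₂ : AbelianVariety ℂ} (h₁ : S₁.dim = 2) (h₂ : S₂.dim = 2) :
    HodgeConjectureFor (S₁.prod S₂).dim (S₁.prod S₂).X :=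
  (isStablyNondegenerate_surface_prod_surface h₁ h₂).hodgeConjectureFor

/-- **The Hodge conjecture for every complex abelian variety isogenous to a power of a product of two abelian
surfaces.** [cite: MoonenZarhin1999LowDim, Thm. 0.1 (4)] [cite: MumfordAV1970, §19 Thm. 1 (pp. 173–174)] -/
theorem hodgeConjectureFor_of_isIsogenous_powSucc_surface_prod_surface {S₁ S₂ Y : AbelianVariety ℂ}
    (h₁ : S₁.dim = 2) (h₂ : S₂.dim = 2) {N : ℕ} (hY : AbelianVariety.IsIsogenous Y ((S₁.prod S₂).powSucc N)) :
    HodgeConjectureFor Y.dim Y.X :=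
  (isStablyNondegenerate_surface_prod_surface h₁ h₂).hodgeConjectureFor_of_isIsogenous_powSucc hY

/-- **EVERY `E × T`, `E` an elliptic curve and `T` a NON-SIMPLE abelian threefold, is stably nondegenerate —
UNCONDITIONAL, no hypothesis** (`T ∼ E' × S` by Poincaré; a simple threefold `T₀` is not an isogeny factor of
`E × (E' × S)`: all homomorphisms `E, E', S → T₀` vanish by dimension). [cite: MoonenZarhin1999LowDim, Thm. 0.1 (4) and §5 (5.4)–(5.5)]
[cite: MumfordAV1970, §19 Thm. 1 (pp. 173–174)] -/
theorem isStablyNondegenerate_curve_prod_threefold_of_not_isSimple {E T : AbelianVariety ℂ} (hE : E.dim = 1)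
    (hT3 : T.dim = 3) (hT : ¬ T.IsSimple) : IsStablyNondegenerate (E.prod T) := by
  refine isStablyNondegenerate_of_dim_eq_four_of_not_isSimple (by rw [dim_prod]; omega)
    (not_isSimple_prod_of_dim_pos (by omega) (by omega)) ?_
  rintro ⟨E₀, T₀, -, hT₀s, hT₀3, -, hT₀X, -⟩
  obtain ⟨E', S, hE', hS2, hTiso⟩ := exists_curve_prod_surface_isIsogenous_of_not_isSimple_threefold hT3 hT
  obtain ⟨g, hg⟩ := (AbelianVariety.IsIsogenous.refl E).prod hTiso
  refine not_avDominatedBy_of_forall_hom_eq_zero (T := T₀) (by omega) (fun π => ?_) (hT₀X.trans_isIsogeny_inv hg)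
  exact prod_hom_eq_zero_of_forall (fun f => hom_eq_zero_of_isSimple_of_dim_lt hT₀s (by omega) f)
    (fun u => prod_hom_eq_zero_of_forall (fun f => hom_eq_zero_of_isSimple_of_dim_lt hT₀s (by omega) f)
      (fun f => hom_eq_zero_of_isSimple_of_dim_lt hT₀s (by omega) f) u) π

/-- **The Hodge conjecture for every power of `E × T`, `E` an elliptic curve, `T` a non-simple threefold —
UNCONDITIONAL.** [cite: MoonenZarhin1999LowDim, Thm. 0.1 (4)] -/
theorem hodgeConjectureFor_powSucc_curve_prod_threefold_of_not_isSimple {E T : AbelianVariety ℂ} (hE : E.dim = 1)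
    (hT3 : T.dim = 3) (hT : ¬ T.IsSimple) (N : ℕ) :
    HodgeConjectureFor ((E.prod T).powSucc N).dim ((E.prod T).powSucc N).X :=
  (isStablyNondegenerate_curve_prod_threefold_of_not_isSimple hE hT3 hT).hodgeConjectureFor_powSucc N

/- **On path**: every target here is a CASE of the summit statement (`HodgeConjectureFor` of a smooth projective
variety; `Motives.AbelianVariety.isSmoothProjective_holds`). -/
example (h : ∀ ⦃n : ℕ⦄ ⦃Y : Literature.AlgebraicGeometry.Motives.SchemeOver ℂ⦄,
      Literature.AlgebraicGeometry.Motives.IsSmoothProjective n Y → HodgeConjectureFor n Y)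
    (X : AbelianVariety ℂ) (N : ℕ) : HodgeConjectureFor (X.powSucc N).dim (X.powSucc N).X :=
  h Literature.AlgebraicGeometry.Motives.AbelianVariety.isSmoothProjective_holds

end Summit.HodgeConjecture.Ring2.NonSimpleFourfolds
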